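/-
Copyright: the b2b-balaban T⁴-continuum CRUX team, row NE7b OWNER lineage `t4-ne7b-p1` (gen 122). Project licence.
-/
import Summits.QuantumFields.BalabanUV.T4Continuum.Spine.NE7b.SupTorusBlockL1Letter

/-!
# `‖H_V⁻¹‖_{ℓ^∞ → ℓ^∞} ≤ C(d, a, λ, Λ)` ON THE ROAD'S OWN CLASS `−λ ≤ V ≤ Λ` (EITHER SIGN, NO MAXIMUM PRINCIPLE), `d ≥ 3` — every source,
# every mesh, every volume: for `H_V = (n+1)²(−Δ) + a(n+1)^{−d}(block sums) + V` on `(ℤ∕(n+1)s)^d`, `λ < min(2,a)`, and ANY `f` with `|f| ≤ M`,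
# every solution of `H_Vu = f` has `|u x| ≤ C·M` — by INTERIOR ELLIPTIC REGULARITY (the tree's `Beta.PoissonInterior.interior_estimate`)
# at the radius `θ(n+1)` read on the periodic lift, the block-`ℓ¹` letter of `H⁻¹` for every source ((151)), and absorption of the
# zeroth-order term (`C(d)θ²(|λ| + Λ) ≤ 1∕4`) — § [NE7bP1-G121-HANDOFF] NEXT (3)(a) «the POINTWISE theory on the ROAD's class `V ≥ −λ` of
# either sign: the maximum principle is unavailable» (row NE7b, node U5c; (144)∕(148)∕(151) BY NAME; [folklore])

Cell `pub-balaban`, sub-cell `t4`, spine estimate NE7b (`T4WeightBudget.RelWeightBound`; the cell's OWN estimate — NOT PRINTED in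
[Bałaban 1983–89], NOT PROVED).  Crux-route work under `Spine/NE7b/` by the row OWNER (`t4-ne7b-p1` gen 122, file (152)) under FREEZE
(0)'s crux-prover clause; NOTHING of Bałaban's is named as a Lean object, valued or asserted; no `T4Continuum/Support` leaf typed; no `def`,
no notation (the action DISPLAYED exactly as in (133)–(151)); zero `sorry`.
Imports (BY NAME): the OWNER's (151) `…SupTorusBlockL1Letter` (`lap_lift`, `blockL1_le_sup`, `blockL1_le_sup_lattice`, `sum_cube_le`;
through it (148) `exists_blockColumns`, `blockMean_le_sup`, (144) `blockTerm_eq`, (131) `exists_rate`, (89) TDF `siteOf_chart_surjective`)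
and, through (151), the β-team's `Beta.PoissonInterior.interior_estimate` (the inhomogeneous interior estimate for the lattice Poisson
equation on `ℤ^d`, `d ≥ 3`: `|u x| ≤ C(d)(m²·sup_{cube(3m)}|Δu| + m^{−d}Σ_{cube(3m)}|u|)`, [folklore], Lawler 1991 Thm 1.7.1's inhomogeneous
`ℓ¹` form, kernel-proved there from lit1's lattice Green function).

WHY (located).  (148) bounds `‖H_V⁻¹‖_{∞→∞}` on the STRICTLY CONVEX class `V ≥ v₀ > 0` by the maximum principle for `L_V = (n+1)²(−Δ) + V`;
on the road's class `V ≥ −λ` of either sign `L_V` is not positive and the maximum principle for `H` fails (the block term `aQ′t*Q′t` is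
positive off the diagonal) — § [NE7bP1-G121-HANDOFF] (3)(a) asked for «lattice heat-kernel bounds → a local mean-value inequality → pointwise
from block-`ℓ²`», a 3–4 file programme.  The tree ALREADY holds the mean-value inequality in the exact form needed (`PoissonInterior.
interior_estimate`, the β-team's input (S2)∕I3, harmonic side in `ℓ¹` of the cube).  Read on the periodic lift `U = u∘σ` of a solution
(`ΔU = −(n+1)^{−2}(f − Vu − a·(block means))∘σ`, (151) `lap_lift` + (144) `blockTerm_eq`), at the radius `3m`, `m = ⌊θ(n+1)⌋`: the source
side costs `m²(n+1)^{−2}(M + (|λ| + Λ)‖u‖_∞ + a·m_κ⁻¹e^{2dκ}K_κM) ≤ θ²(…)`, the `ℓ¹` side `m^{−d}·3^d(n+1)^d·m_κ⁻¹e^{2dκ}K_κM ≤ 3^d(2∕θ)^d(…)M`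
((151) `sum_cube_le` ⊛ `blockL1_le_sup_lattice`); at the maximum of `|u|` the term `C(d)θ²(|λ| + Λ)‖u‖_∞ ≤ ‖u‖_∞∕4` is absorbed.  Meshes
with `θ(n+1) < 2` have `≤ (2∕θ)^d` sites per block and the block-`ℓ¹` letter is already pointwise.

WHAT IS PROVED ([folklore]; fine torus `Site d ((n+1)s)`, coarse `Site d s`, `[NeZero s]`; the action DISPLAYED; `σ = siteOf`,
`m_κ = min(2,a) − λ − 2dκ² − a(e^{2dκ} − 1)`; `K_κ = (2∕(1 − e^{−κ}))^d`):
* §1 THE HEADLINE **`supNorm_bound_road`**: `d ≥ 3`, `a > 0`, `λ < min(2,a)`, `Λ ≥ 0` ⟹ `∃ C > 0` (a function of `(d, a, λ, Λ)` and the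
  interior constant `C(d)`) such that for ALL `n, s`, ALL `−λ ≤ V ≤ Λ`, EVERY `f` with `|f| ≤ M` and every `Hu = f`: `|u x| ≤ C·M` at every site.
* §2 toy (`d = 3`).

HONEST (what this is NOT).  `d ≥ 3` only (transience of the lattice Green function behind `interior_estimate`; `d = 4` is the cell's case;
the statement is true in every `d`); an operator-NORM bound, not decay (the pointwise DECAY from a block source on the road's class is the
next file, same mechanism with exponential weights); `C` inherits lit1's existential Green-function constants (useless for numerics);
constants far from sharp; cubic periods; scalar skeleton ((A3), NC-NE7b-α UNRULED); nothing of the covariant propagators of [B4]–[B6];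
nothing of Bałaban's.  BY-NAME EFFECT ON THE WALL: NONE.  NE7b NOT PRINTED ∕ NOT PROVED; spine PROVED 0∕9; rung (B)+1 on a FINITE torus —
NOT infinite volume, NOT the mass gap, NOT Clay.  HONEST DEPENDENCY: continuum YM on T⁴ ⇐ BetaPertH ∧ nine spine estimates (0∕9 proved);
BetaPertH ⇐ (D1) ∧ (D4) ∧ CAP+tail; G-an2-4 gates asym, D1 and NE2∕3∕4.
-/

set_option autoImplicit false

noncomputable section

namespace Summit.QuantumFields.BalabanUV.T4Continuum.NE7b.SupTorusSupNormRoad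

open Real
open Literature.MathematicalPhysics.QuantumFieldTheory.Balaban1983to89
open Literature.Probability.LatticeModels (latticeLaplacianZd)
open B6QGQLower276 (X e blk B side chart mem_B sum_B sum_B_const card_cube blk_chart)
open Beta (Site siteOf windowMap siteOf_windowMap siteOf_add siteOf_sub)
open Beta.PoissonInterior (cube mem_cube interior_estimate)
open SupTorusDirichletForm (siteOf_chart_surjective)
open SupTorusHessianCombesThomas (exists_rate)
open SupTorusMaximumPrinciple (blockTerm_eq)
open SupTorusSupNormBound (exists_blockColumns blockMean_le_sup)
open SupTorusBlockL1Letter (lap_lift blockL1_le_sup blockL1_le_sup_lattice sum_cube_le)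

variable {d : ℕ}

/-! ## §1. THE END: `‖H_V⁻¹‖_{ℓ^∞ → ℓ^∞} ≤ C(d, a, λ, Λ)` on the road's class, every source, every mesh, every volume -/

/-- **HEADLINE — THE PROPAGATOR OF THE TORUS ROAD IS BOUNDED ON `ℓ^∞`, MESH- AND VOLUME-FREE, ON THE ROAD'S OWN CLASS `−λ ≤ V ≤ Λ`
(EITHER SIGN), `d ≥ 3`.**  Fix `d ≥ 3`, `a > 0`, `λ < min(2,a)`, `Λ ≥ 0`.  THERE IS `C > 0` (a function of these and of the interior constant
`C(d)` of `PoissonInterior.interior_estimate` only) such that for ALL `n, s`, ALL potentials `−λ ≤ V ≤ Λ`, EVERY source `f` with `|f| ≤ M` (no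
support condition) and every solution of `Hu = f` (displayed action): `|u x| ≤ C·M` at EVERY site.  Proof: at the maximum `x₀` of `|u|`, the
interior estimate for the periodic lift `u∘σ` at radius `3m`, `m = ⌊θ(n+1)⌋`, with `|Δ(u∘σ)| ≤ (n+1)^{−2}(M + (|λ|+Λ)|u x₀| + a·m_κ⁻¹e^{2dκ}K_κM)`
(§1, (148) `blockMean_le_sup`) and `Σ_{cube}|u∘σ| ≤ 3^d(n+1)^d·m_κ⁻¹e^{2dκ}K_κM` (§2–§3); `θ` is chosen with `C(d)θ²(|λ| + Λ) ≤ 1∕4`, `θ ≤ 1∕3`,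
and the zeroth-order term is absorbed; meshes with `θ(n+1) < 2` are read off §2 directly.  § [NE7bP1-G121-HANDOFF] NEXT (3)(a) on the
road's class, with NO hypothesis left. [folklore] -/
theorem supNorm_bound_road (hd : 3 ≤ d) (a : ℝ) (ha : 0 < a) {lam Lam : ℝ} (hlam : lam < min 2 a) (hLam : 0 ≤ Lam) :
    ∃ C : ℝ, 0 < C ∧ ∀ (n s : ℕ) [NeZero s] (V : Site d ((n + 1) * s) → ℝ), (∀ x, -lam ≤ V x) → (∀ x, V x ≤ Lam) →
      ∀ (M : ℝ) (u f : Site d ((n + 1) * s) → ℝ), (∀ x, |f x| ≤ M) →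
      (∀ x, ((n : ℝ) + 1) ^ 2 * ∑ μ, (2 * u x - u (x + siteOf d ((n + 1) * s) (e μ)) - u (x - siteOf d ((n + 1) * s) (e μ)))
        + a / ((n : ℝ) + 1) ^ d * ∑ q ∈ B n (blk n (windowMap d ((n + 1) * s) x)), u (siteOf d ((n + 1) * s) q) + V x * u x = f x) →
      ∀ x : Site d ((n + 1) * s), |u x| ≤ C * M := by
  classical
  have hdR : (0 : ℝ) ≤ d := Nat.cast_nonneg d
  have hm0 : 0 < min 2 a - lam := by linarith
  obtain ⟨κ, hκ0, hκ1, hκm⟩ := exists_rate (d := d) a ha.le hm0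
  have hm : 0 < min 2 a - lam - 2 * d * κ ^ 2 - a * (exp (2 * d * κ) - 1) := by linarith
  set m := min 2 a - lam - 2 * d * κ ^ 2 - a * (exp (2 * d * κ) - 1) with hm_def
  set K : ℝ := (2 * (1 - exp (-κ))⁻¹) ^ d with hK
  have hK0 : 0 ≤ K := pow_nonneg (mul_nonneg zero_le_two (inv_nonneg.2 (sub_nonneg.2 (exp_le_one_iff.2 (by linarith))))) d
  have hminv : 0 ≤ m⁻¹ := inv_nonneg.2 hm.le
  -- the duality constant `Cd = m_κ⁻¹e^{2dκ}K_κ`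
  set Cd : ℝ := m⁻¹ * exp (2 * d * κ) * K with hCd
  have hCd0 : 0 ≤ Cd := by positivity
  -- the interior constant
  obtain ⟨CI, hCI0, hI⟩ := interior_estimate hd
  -- the size of the potential and the radius fraction `θ`
  set L : ℝ := |lam| + Lam with hL
  have hL0 : 0 ≤ L := by positivity
  set θ : ℝ := min (1 / 3) (1 / (4 * (CI * L + 1))) with hθ
  have hθ0 : 0 < θ := lt_min (by norm_num) (by positivity)
  have hθ3 : θ ≤ 1 / 3 := min_le_left _ _
  have hθ1 : θ ≤ 1 := hθ3.trans (by norm_num)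
  have hθabs : CI * L * θ ^ 2 ≤ 1 / 4 := by
    have h1 : θ ≤ 1 / (4 * (CI * L + 1)) := min_le_right _ _
    have h2 : θ ^ 2 ≤ θ * (1 / (4 * (CI * L + 1))) := by
      rw [sq]; exact mul_le_mul_of_nonneg_left h1 hθ0.le
    have h3 : CI * L * (θ * (1 / (4 * (CI * L + 1)))) = θ / 4 * (CI * L / (CI * L + 1)) := by
      field_simp
    have h4 : CI * L / (CI * L + 1) ≤ 1 := by rw [div_le_one (by positivity)]; linarith
    calc CI * L * θ ^ 2 ≤ CI * L * (θ * (1 / (4 * (CI * L + 1)))) := mul_le_mul_of_nonneg_left h2 (by positivity)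
      _ = θ / 4 * (CI * L / (CI * L + 1)) := h3
      _ ≤ θ / 4 * 1 := mul_le_mul_of_nonneg_left h4 (by positivity)
      _ ≤ 1 / 4 := by linarith
  -- the two constants: small meshes, large meshes
  set K₁ : ℝ := (2 / θ) ^ d * Cd with hK₁
  set K₂ : ℝ := 2 * CI * (θ ^ 2 * (1 + a * Cd) + 3 ^ d * Cd * (2 / θ) ^ d) with hK₂
  have hK₁0 : 0 ≤ K₁ := by positivity
  have hK₂0 : 0 ≤ K₂ := by positivity
  refine ⟨max K₁ K₂ + 1, by positivity, ?_⟩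
  intro n s _ V hV hV' M u f hfM hu x
  have hM : 0 ≤ M := (abs_nonneg _).trans (hfM x)
  have hn1 : (0 : ℝ) < (n : ℝ) + 1 := by positivity
  have hvol : (0 : ℝ) < ((n : ℝ) + 1) ^ d := by positivity
  have hVabs : ∀ x', |V x'| ≤ L := fun x' => by
    rw [hL, abs_le]; constructor <;> linarith [hV x', hV' x', le_abs_self lam, neg_abs_le lam]
  -- block means and block `ℓ¹` norms of `u`, every block
  obtain ⟨ψ, hψ⟩ := exists_blockColumns n a s ha.le hm0 V hV
  have hmean : ∀ y : Site d s, |(((n : ℝ) + 1) ^ d)⁻¹ * ∑ z : Fin d → Fin (n + 1), u (siteOf d ((n + 1) * s) (chart n (windowMap d s y) z))|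
      ≤ Cd * M := fun y => by
    have h := blockMean_le_sup n a s ha.le hκ0 hκ1 hm V hV ψ hψ u f hu hfM y
    rw [hCd]; exact h
  have hL1 : ∀ b : X d, ∑ q ∈ B n b, |u (siteOf d ((n + 1) * s) q)| ≤ ((n : ℝ) + 1) ^ d * Cd * M := fun b => by
    have h := blockL1_le_sup_lattice n a s ha.le hκ0 hκ1 hm V hV u f hu hfM b
    rw [hCd]; linarith [h]
  -- the maximum of `|u|`
  obtain ⟨x₀, hx₀⟩ := Finite.exists_max fun x' => |u x'|
  set S := |u x₀| with hS_def
  have hS0 : 0 ≤ S := abs_nonneg _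
  have hSx : ∀ x', |u x'| ≤ S := hx₀
  suffices hmain : S ≤ max K₁ K₂ * M by
    calc |u x| ≤ S := hSx x
      _ ≤ max K₁ K₂ * M := hmain
      _ ≤ (max K₁ K₂ + 1) * M := by rw [add_mul, one_mul]; linarith
  by_cases hsmall : θ * ((n : ℝ) + 1) < 2
  · -- small meshes: the block `ℓ¹` letter is already pointwise
    obtain ⟨⟨y, z⟩, hyz⟩ := siteOf_chart_surjective n s x₀
    simp only at hyz
    have h1 : S ≤ ∑ z' : Fin d → Fin (n + 1), |u (siteOf d ((n + 1) * s) (chart n (windowMap d s y) z'))| := by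
      rw [hS_def, ← hyz]
      exact Finset.single_le_sum (f := fun z' => |u (siteOf d ((n + 1) * s) (chart n (windowMap d s y) z'))|)
        (fun _ _ => abs_nonneg _) (Finset.mem_univ z)
    have h2 := blockL1_le_sup n a s ha.le hκ0 hκ1 hm V hV u f hu hfM y
    have h3 : ((n : ℝ) + 1) ^ d ≤ (2 / θ) ^ d := by
      refine pow_le_pow_left₀ hn1.le ?_ d
      rw [le_div_iff₀ hθ0]; linarith
    calc S ≤ ((n : ℝ) + 1) ^ d * (m⁻¹ * exp (2 * d * κ) * K) * M := h1.trans h2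
      _ ≤ (2 / θ) ^ d * (m⁻¹ * exp (2 * d * κ) * K) * M :=
          mul_le_mul_of_nonneg_right (mul_le_mul_of_nonneg_right h3 (by positivity)) hM
      _ = K₁ * M := by rw [hK₁, hCd]
      _ ≤ max K₁ K₂ * M := mul_le_mul_of_nonneg_right (le_max_left _ _) hM
  · -- large meshes: interior regularity at the radius `3m`, `m = ⌊θ(n+1)⌋`
    have hsmall' : 2 ≤ θ * ((n : ℝ) + 1) := not_lt.1 hsmall
    set mm : ℕ := ⌊θ * ((n : ℝ) + 1)⌋₊ with hmm
    have hmm_le : (mm : ℝ) ≤ θ * ((n : ℝ) + 1) := Nat.floor_le (by positivity)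
    have hmm_ge : θ * ((n : ℝ) + 1) / 2 ≤ mm := by
      have := Nat.lt_floor_add_one (θ * ((n : ℝ) + 1))
      rw [← hmm] at this
      linarith
    have hmm2 : 2 ≤ mm := Nat.le_floor (by exact_mod_cast hsmall')
    have hmm1 : 1 ≤ mm := le_trans (by norm_num) hmm2
    have hmmR : (0 : ℝ) < mm := by exact_mod_cast (lt_of_lt_of_le zero_lt_one hmm1)
    have h3m : 3 * mm ≤ n + 1 := by
      have h : ((3 * mm : ℕ) : ℝ) ≤ ((n + 1 : ℕ) : ℝ) := by
        push_cast
        calc (3 : ℝ) * mm ≤ 3 * (θ * ((n : ℝ) + 1)) := by linarith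
          _ ≤ 3 * ((1 / 3) * ((n : ℝ) + 1)) := by
              have := mul_le_mul_of_nonneg_right hθ3 hn1.le
              linarith
          _ = (n : ℝ) + 1 := by ring
      exact_mod_cast h
    -- the periodic lift and its two sizes on the cube about a representative of `x₀`
    set q₀ : X d := windowMap d ((n + 1) * s) x₀ with hq₀
    set A : ℝ := (M + L * S + a * (Cd * M)) / ((n : ℝ) + 1) ^ 2 with hA
    set Bsum : ℝ := 3 ^ d * (((n : ℝ) + 1) ^ d * Cd * M) with hB
    have hlap : ∀ p ∈ cube q₀ (3 * mm), |latticeLaplacianZd (fun p' : X d => u (siteOf d ((n + 1) * s) p')) p| ≤ A := by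
      intro p _
      rw [lap_lift, abs_neg]
      obtain ⟨⟨y, z⟩, hyz⟩ := siteOf_chart_surjective n s (siteOf d ((n + 1) * s) p)
      simp only at hyz
      have hx := hu (siteOf d ((n + 1) * s) p)
      rw [← hyz] at hx ⊢
      rw [blockTerm_eq n s u y z] at hx
      set x' := siteOf d ((n + 1) * s) (chart n (windowMap d s y) z) with hx'
      set T := ∑ μ, (2 * u x' - u (x' + siteOf d ((n + 1) * s) (e μ)) - u (x' - siteOf d ((n + 1) * s) (e μ))) with hT
      have hsq : (0 : ℝ) < ((n : ℝ) + 1) ^ 2 := by positivity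
      have hT' : T = (f x' - a * ((((n : ℝ) + 1) ^ d)⁻¹ * ∑ z' : Fin d → Fin (n + 1), u (siteOf d ((n + 1) * s)
          (chart n (windowMap d s y) z'))) - V x' * u x') / ((n : ℝ) + 1) ^ 2 := by
        rw [eq_div_iff hsq.ne']
        rw [div_eq_mul_inv] at hx
        linarith [hx]
      rw [hT', abs_div, abs_of_pos hsq, hA, div_le_div_iff_of_pos_right hsq]
      have k1 : |f x'| ≤ M := hfM x'
      have k2 : |a * ((((n : ℝ) + 1) ^ d)⁻¹ * ∑ z' : Fin d → Fin (n + 1), u (siteOf d ((n + 1) * s) (chart n (windowMap d s y) z')))|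
          ≤ a * (Cd * M) := by
        rw [abs_mul, abs_of_pos ha]; exact mul_le_mul_of_nonneg_left (hmean y) ha.le
      have k3 : |V x' * u x'| ≤ L * S := by
        rw [abs_mul]; exact mul_le_mul (hVabs x') (hSx x') (abs_nonneg _) hL0
      calc |f x' - a * ((((n : ℝ) + 1) ^ d)⁻¹ * ∑ z' : Fin d → Fin (n + 1), u (siteOf d ((n + 1) * s) (chart n (windowMap d s y) z')))
            - V x' * u x'|
          ≤ |f x' - a * ((((n : ℝ) + 1) ^ d)⁻¹ * ∑ z' : Fin d → Fin (n + 1), u (siteOf d ((n + 1) * s) (chart n (windowMap d s y) z')))|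
            + |V x' * u x'| := abs_sub _ _
        _ ≤ |f x'| + |a * ((((n : ℝ) + 1) ^ d)⁻¹ * ∑ z' : Fin d → Fin (n + 1), u (siteOf d ((n + 1) * s) (chart n (windowMap d s y) z')))|
            + |V x' * u x'| := by linarith [abs_sub (f x') (a * ((((n : ℝ) + 1) ^ d)⁻¹
              * ∑ z' : Fin d → Fin (n + 1), u (siteOf d ((n + 1) * s) (chart n (windowMap d s y) z'))))]
        _ ≤ M + L * S + a * (Cd * M) := by linarith
    have hl1 : ∑ p ∈ cube q₀ (3 * mm), |u (siteOf d ((n + 1) * s) p)| ≤ Bsum :=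
      sum_cube_le h3m q₀ (F := fun p => |u (siteOf d ((n + 1) * s) p)|) (fun _ => abs_nonneg _) hL1
    -- the interior estimate at `q₀`
    have hint0 := (hI mm hmm1 (fun p' : X d => u (siteOf d ((n + 1) * s) p')) q₀ A Bsum hlap hl1).1
    have e2 : siteOf d ((n + 1) * s) q₀ = x₀ := by rw [hq₀, siteOf_windowMap]
    have hint : S ≤ CI * ((mm : ℝ) ^ 2 * A + Bsum / (mm : ℝ) ^ d) := by
      rw [hS_def, ← e2]; exact hint0
    -- sizes: `m²A ≤ θ²(M + LS + aCdM)`, `Bsum∕m^d ≤ 3^d(2∕θ)^d·Cd·M`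
    have hA0 : 0 ≤ M + L * S + a * (Cd * M) := by positivity
    have hmA : (mm : ℝ) ^ 2 * A ≤ θ ^ 2 * (M + L * S + a * (Cd * M)) := by
      have h1 : (mm : ℝ) ^ 2 ≤ θ ^ 2 * ((n : ℝ) + 1) ^ 2 := by
        rw [← mul_pow]; exact pow_le_pow_left₀ hmmR.le hmm_le 2
      have h2 : (mm : ℝ) ^ 2 / ((n : ℝ) + 1) ^ 2 ≤ θ ^ 2 := by rwa [div_le_iff₀ (by positivity)]
      calc (mm : ℝ) ^ 2 * A = (mm : ℝ) ^ 2 / ((n : ℝ) + 1) ^ 2 * (M + L * S + a * (Cd * M)) := by rw [hA]; ring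
        _ ≤ θ ^ 2 * (M + L * S + a * (Cd * M)) := mul_le_mul_of_nonneg_right h2 hA0
    have hmB : Bsum / (mm : ℝ) ^ d ≤ 3 ^ d * Cd * (2 / θ) ^ d * M := by
      have hr : (n : ℝ) + 1 ≤ 2 / θ * mm := by
        rw [div_mul_eq_mul_div, le_div_iff₀ hθ0]; linarith
      have h1 : ((n : ℝ) + 1) ^ d ≤ (2 / θ) ^ d * (mm : ℝ) ^ d := by
        rw [← mul_pow]; exact pow_le_pow_left₀ hn1.le hr d
      have h2 : ((n : ℝ) + 1) ^ d / (mm : ℝ) ^ d ≤ (2 / θ) ^ d := by rwa [div_le_iff₀ (by positivity)]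
      calc Bsum / (mm : ℝ) ^ d = 3 ^ d * Cd * M * (((n : ℝ) + 1) ^ d / (mm : ℝ) ^ d) := by rw [hB]; ring
        _ ≤ 3 ^ d * Cd * M * (2 / θ) ^ d := mul_le_mul_of_nonneg_left h2 (by positivity)
        _ = 3 ^ d * Cd * (2 / θ) ^ d * M := by ring
    -- absorb the zeroth-order term
    have hS1 : S ≤ CI * (θ ^ 2 * (M + L * S + a * (Cd * M)) + 3 ^ d * Cd * (2 / θ) ^ d * M) := by
      refine hint.trans (mul_le_mul_of_nonneg_left (add_le_add hmA hmB) hCI0)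
    have hS2 : S ≤ (1 / 4) * S + (K₂ / 2) * M := by
      have e : CI * (θ ^ 2 * (M + L * S + a * (Cd * M)) + 3 ^ d * Cd * (2 / θ) ^ d * M)
          = CI * L * θ ^ 2 * S + (K₂ / 2) * M := by rw [hK₂]; ring
      rw [e] at hS1
      have h4 := mul_le_mul_of_nonneg_right hθabs hS0
      linarith
    have hS3 : S ≤ K₂ * M := by
      have : 0 ≤ K₂ * M := by positivity
      linarith
    exact hS3.trans (mul_le_mul_of_nonneg_right (le_max_right _ _) hM)

/-! ## §2. Toy -/

/-- Toy (`d = 3`, `a = 1`, `λ = 0`, `Λ = 1`): the headline's hypotheses are inhabited, so the constant exists. -/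
example : ∃ C : ℝ, 0 < C :=
  let ⟨C, hC, _⟩ := supNorm_bound_road (d := 3) le_rfl 1 one_pos (lam := 0) (Lam := 1)
    (by rw [min_eq_right (by norm_num : (1 : ℝ) ≤ 2)]; norm_num) zero_le_one
  ⟨C, hC⟩

end Summit.QuantumFields.BalabanUV.T4Continuum.NE7b.SupTorusSupNormRoad
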